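import Mathlib.RingTheory.PowerSeries.Inverse
import Mathlib.Analysis.Normed.Ring.InfiniteSum
import Literature.NumberTheory.EllipticCurves.PAdicHeightsProofs
import HarnessLib

/-!
# Tate's `q`-expansions as integer formal power series, and their non-archimedean evaluation

`PAdicHeights.lean` defines `E₄(q)`, `Δ(q) = q ∏ (1 - qⁿ)²⁴` and `j(q) = E₄(q)³/Δ(q)` (`tateE4`,
`tateDelta`, `tateJ`) *analytically* (`tsum`/`tprod` in a normed field).  Transcendence arguments
about `J(q)` (Mahler–Manin, `Literature.NumberTheory.Transcendental.MahlerManinPadic`, on which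
`WeierstrassCurve.LInvariant_ne_zero` rests) manipulate the FORMAL `q`-expansion with integer
coefficients `z J(z) = 1 + 744 z + ∑ c(n) z^{n+1}` (Nesterenko–Philippon LNM 1752, Ch. 2,
Prop. 2.1 (3), 2.2 (3), 2.3 (3): `Δ j = E₄³`) and its powers (Siegel's lemma), then EVALUATE
`p`-adically.  This file provides that formal object and the evaluation bridge:

* `formalE4`, `formalDeltaUnit` (`= Δ/q = ∏_{m ≥ 1}(1 - qᵐ)²⁴`, defined through the stabilising
  truncated products `deltaFactorProd N`), `formalXJ = E₄³ · (Δ/q)⁻¹ ∈ ℤ⟦q⟧` — REAL definitions;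
  `coeff_zero_formalXJ = 1`, `coeff_one_formalXJ = 744` (the familiar `j = 1/q + 744 + ⋯`).
* `evalSeries φ z = ∑' n, coeffₙ(φ) zⁿ` for `φ ∈ ℤ⟦q⟧` and `z` in a complete ultrametric normed
  field; it is additive and MULTIPLICATIVE on the open unit disc (`evalSeries_mul`, Cauchy
  product of norm-summable series) and bounded by `1` (`norm_evalSeries_le_one`).
* `evalSeries_formalE4 : evalSeries formalE4 q = tateE4 q`,
  `evalSeries_formalDeltaUnit : evalSeries formalDeltaUnit q = ∏' (1 - q^{m+1})²⁴` (limit of the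
  truncated products, error `≤ ‖q‖^{N+1}`), and the main bridge
  **`evalSeries_formalXJ : evalSeries formalXJ q = q · tateJ q`** (`0 < ‖q‖ < 1`), also as
  `hasSum_coeff_formalXJ`.

Not here: the identification with the `q`-expansions of Mathlib's complex modular forms `E₄`, `Δ`
(archimedean growth of coefficients) and the modular polynomials (later programme items).

## Overlaps with the tree (named explicitly; D-0014 dedup)

* `formalE4` is the SAME integer power series as
  `Literature.Barriers.Schanuel.ramanujanQSeries := 1 + 240 * sigmaSeries 3`
  (`Literature/Barriers/Schanuel/NesterenkoModularScopeSeries.lean`, l.128, with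
  `coeff_ramanujanQSeries`, vendored for the Nesterenko Ch. 3 barrier programme); the two are
  provably equal coefficientwise (`ext n; rw [coeff_mk, coeff_ramanujanQSeries]; split_ifs <;> simp`).
  This file is the canonical TOPICAL copy (barrier files import topical literature, not
  conversely), kept next to the analytic `tateE4` it evaluates to.  refactor: a librarian should
  redefine `Literature.Barriers.Schanuel.ramanujanQSeries` as (an `abbrev` of) `formalE4`, or add
  the lemma `ramanujanQSeries = formalE4` in the Schanuel file (which may import this one).
* `evalSeries_mul` is the `K`-general twin (complete ultrametric field) of the `ℂ`-specific
  `Literature.NumberTheory.EllipticCurves.tsum_coeff_mul_pow_mul` (`BSDGoldfeldEulerProduct.lean`,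
  l.151); same proof, kept separate until a common normed-field version collapses both.

## References

* [NesterenkoPhilippon2001] LNM 1752, Ch. 2 (G. Diaz), Prop. 2.1–2.3 and §2.5 (first step).
* J.-P. Serre, *A Course in Arithmetic*, GTM 7, VII §3.3, §4 (`E₄`, `Δ`, `j = 1/q + 744 + ⋯`).
* [SilvermanATAEC1994] Silverman, ATAEC, Thm. V.3.1 (Tate's `q`-expansions over complete fields).
-/

noncomputable section

open Filter Topology IsUltrametricDist PowerSeries Finset
open scoped ArithmeticFunction.sigma

namespace Literature.NumberTheory.EllipticCurves

/-! ### The integer formal power series -/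

/-- The normalised Eisenstein series of weight `4` as an INTEGER formal power series,
`E₄ = 1 + 240 ∑_{n ≥ 1} σ₃(n) qⁿ ∈ ℤ⟦q⟧` (Serre, *Cours d'arithmétique* VII §4.2;
Nesterenko–Philippon LNM 1752 Ch. 2 Prop. 2.3).  Its evaluation at `‖q‖ < 1` in a complete
ultrametric field is `Literature.NumberTheory.EllipticCurves.tateE4 q` (`evalSeries_formalE4`).
Same series as `Literature.Barriers.Schanuel.ramanujanQSeries` (Nesterenko's `Q`; see the module
docstring, "Overlaps"). [cite: NesterenkoPhilippon2001, Ch. 2, Prop. 2.3] -/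
def formalE4 : PowerSeries ℤ :=
  PowerSeries.mk fun n ↦ if n = 0 then 1 else 240 * (σ 3 n : ℤ)

/-- The truncated product `∏_{m < N} (1 - q^{m+1})²⁴ ∈ ℤ⟦q⟧` (a polynomial). [folklore] -/
def deltaFactorProd (N : ℕ) : PowerSeries ℤ :=
  ∏ m ∈ Finset.range N, (1 - (PowerSeries.X : PowerSeries ℤ) ^ (m + 1)) ^ 24

/-- `Δ(q)/q = ∏_{m ≥ 1} (1 - qᵐ)²⁴ = 1 - 24q + 252q² - ⋯ ∈ ℤ⟦q⟧` as an integer formal power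
series: its `n`-th coefficient is that of the finite product `∏_{m ≤ n} (1 - qᵐ)²⁴` (the later
factors are `≡ 1 (mod q^{n+1})`, `coeff_deltaFactorProd_of_le`).  (Nesterenko–Philippon Ch. 2
Prop. 2.2 (3): `Δ(z) = z ∏ (1 - zⁿ)²⁴`.) [cite: NesterenkoPhilippon2001, Ch. 2, Prop. 2.2] -/
def formalDeltaUnit : PowerSeries ℤ :=
  PowerSeries.mk fun n ↦ coeff n (deltaFactorProd n)

/-- `q · j(q) = E₄(q)³ / (Δ(q)/q) = 1 + 744 q + 196884 q² + ⋯ ∈ ℤ⟦q⟧`: the `q`-expansion of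
Klein's invariant times `q`, as an integer formal power series (`Δ · j = E₄³`,
Nesterenko–Philippon Ch. 2 Prop. 2.3 (3) and Prop. 2.1 (3): `J(z) = 1/z + 744 + ∑ c(n) zⁿ`,
`c(n) ∈ ℕ`).  `formalDeltaUnit` has constant term `1`, so it is inverted by
`PowerSeries.invOfUnit`. [cite: NesterenkoPhilippon2001, Ch. 2, Prop. 2.1] -/
def formalXJ : PowerSeries ℤ :=
  formalE4 ^ 3 * PowerSeries.invOfUnit formalDeltaUnit 1

/-- Coefficients of `formalE4`. [folklore] -/
@[simp]
theorem coeff_formalE4 (n : ℕ) :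
    coeff n formalE4 = if n = 0 then 1 else 240 * (σ 3 n : ℤ) :=
  coeff_mk _ _

/-- `E₄` has constant term `1`. [folklore] -/
@[simp]
theorem constantCoeff_formalE4 : constantCoeff formalE4 = 1 := by
  rw [← coeff_zero_eq_constantCoeff_apply, coeff_formalE4, if_pos rfl]

/-- `(1 - q^k)²⁴ ≡ 1 (mod q^k)`. [folklore] -/
theorem exists_one_sub_X_pow_pow_eq (k : ℕ) :
    ∃ R : PowerSeries ℤ, (1 - (X : PowerSeries ℤ) ^ k) ^ 24 = 1 + X ^ k * R := by
  obtain ⟨R, hR⟩ := sub_dvd_pow_sub_pow (1 - (X : PowerSeries ℤ) ^ k) 1 24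
  refine ⟨-R, ?_⟩
  rw [one_pow, sub_sub_cancel_left] at hR
  linear_combination hR

/-- Multiplying by `(1 - q^k)²⁴` does not change coefficients below `q^k`. [folklore] -/
theorem coeff_mul_one_sub_X_pow_pow {n k : ℕ} (h : n < k) (φ : PowerSeries ℤ) :
    coeff n (φ * (1 - X ^ k) ^ 24) = coeff n φ := by
  obtain ⟨R, hR⟩ := exists_one_sub_X_pow_pow_eq k
  rw [hR, mul_add, mul_one, map_add, mul_left_comm, coeff_X_pow_mul', if_neg (not_le.mpr h),
    add_zero]

/-- The coefficients of the truncated products stabilise: for `n ≤ N`, the `n`-th coefficient of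
`∏_{m < N} (1 - q^{m+1})²⁴` is that of `∏_{m < n} (1 - q^{m+1})²⁴`. [folklore] -/
theorem coeff_deltaFactorProd_of_le {n N : ℕ} (h : n ≤ N) :
    coeff n (deltaFactorProd N) = coeff n (deltaFactorProd n) := by
  induction N, h using Nat.le_induction with
  | base => rfl
  | succ N hnN ih =>
    rw [deltaFactorProd, Finset.prod_range_succ, ← deltaFactorProd,
      coeff_mul_one_sub_X_pow_pow (Nat.lt_succ_of_le hnN), ih]

/-- The `n`-th coefficient of `Δ/q` is that of any long enough truncated product. [folklore] -/
theorem coeff_formalDeltaUnit {n N : ℕ} (h : n ≤ N) :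
    coeff n formalDeltaUnit = coeff n (deltaFactorProd N) := by
  rw [formalDeltaUnit, coeff_mk, coeff_deltaFactorProd_of_le h]

/-- `Δ/q` has constant term `1`. [folklore] -/
@[simp]
theorem constantCoeff_formalDeltaUnit : constantCoeff formalDeltaUnit = 1 := by
  rw [← coeff_zero_eq_constantCoeff_apply, formalDeltaUnit, coeff_mk, deltaFactorProd,
    Finset.range_zero, Finset.prod_empty, coeff_zero_eq_constantCoeff_apply, map_one]

/-- `(Δ/q) · (Δ/q)⁻¹ = 1` in `ℤ⟦q⟧`. [folklore] -/
theorem formalDeltaUnit_mul_invOfUnit : formalDeltaUnit * invOfUnit formalDeltaUnit 1 = 1 :=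
  mul_invOfUnit _ _ (by simp)

/-- `q·j` has constant term `1`. [folklore] -/
@[simp]
theorem constantCoeff_formalXJ : constantCoeff formalXJ = 1 := by
  simp [formalXJ]

/-! ### The first two coefficients: `q · j = 1 + 744 q + ⋯` -/

/-- `coeff 1 (φ ψ) = coeff 0 φ · coeff 1 ψ + coeff 1 φ · coeff 0 ψ`. [folklore] -/
theorem coeff_one_mul (φ ψ : PowerSeries ℤ) :
    coeff 1 (φ * ψ) = coeff 0 φ * coeff 1 ψ + coeff 1 φ * coeff 0 ψ := by
  rw [coeff_mul, Finset.Nat.antidiagonal_succ, Finset.sum_cons, Finset.Nat.antidiagonal_zero,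
    Finset.map_singleton, Finset.sum_singleton]
  rfl

/-- `coeff 1 ((1 - q)²⁴ ⋯)`: the linear coefficient of `(1 - X)^k` is `-k`. [folklore] -/
theorem coeff_one_one_sub_X_pow (k : ℕ) :
    coeff 1 ((1 - (X : PowerSeries ℤ)) ^ k) = -(k : ℤ) ∧ coeff 0 ((1 - (X : PowerSeries ℤ)) ^ k) = 1 := by
  induction k with
  | zero => simp [coeff_one]
  | succ k ih =>
    obtain ⟨h1, h0⟩ := ih
    refine ⟨?_, ?_⟩
    · rw [pow_succ, coeff_one_mul, h1, h0]
      simp [coeff_one, coeff_one_X]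
    · rw [pow_succ, coeff_zero_eq_constantCoeff_apply, map_mul, ← coeff_zero_eq_constantCoeff_apply,
        h0]
      simp

/-- `Δ/q = 1 - 24 q + ⋯`. [folklore] -/
theorem coeff_one_formalDeltaUnit : coeff 1 formalDeltaUnit = -24 := by
  rw [coeff_formalDeltaUnit (le_refl 1), deltaFactorProd, Finset.prod_range_one, zero_add, pow_one]
  exact_mod_cast (coeff_one_one_sub_X_pow 24).1

/-- `E₄³ = 1 + 720 q + ⋯`. [folklore] -/
theorem coeff_one_formalE4_pow_three : coeff 1 (formalE4 ^ 3) = 720 := by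
  have h0 : coeff 0 formalE4 = 1 := by
    rw [coeff_zero_eq_constantCoeff_apply, constantCoeff_formalE4]
  have h00 : coeff 0 (formalE4 * formalE4) = 1 := by
    rw [coeff_zero_eq_constantCoeff_apply, map_mul, constantCoeff_formalE4, one_mul]
  have h1 : coeff 1 formalE4 = 240 := by
    rw [coeff_formalE4, if_neg one_ne_zero, ArithmeticFunction.sigma_one]; norm_num
  rw [pow_succ, coeff_one_mul, pow_two, coeff_one_mul, h0, h00, h1]
  norm_num

/-- `(Δ/q)⁻¹ = 1 + 24 q + ⋯`. [folklore] -/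
theorem coeff_one_invOfUnit_formalDeltaUnit :
    coeff 1 (PowerSeries.invOfUnit formalDeltaUnit 1) = 24 := by
  rw [coeff_invOfUnit, if_neg one_ne_zero, Finset.Nat.antidiagonal_succ, Finset.sum_cons,
    Finset.Nat.antidiagonal_zero, Finset.map_singleton, Finset.sum_singleton]
  simp [coeff_one_formalDeltaUnit]

/-- **`q · j(q) = 1 + 744 q + ⋯`**: the constant and linear coefficients of `formalXJ` are `1`
and `744` (Nesterenko–Philippon Ch. 2 Prop. 2.1 (3): `J(z) = 1/z + 744 + ∑ c(n) zⁿ`).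
[cite: NesterenkoPhilippon2001, Ch. 2, Prop. 2.1] -/
theorem coeff_one_formalXJ : coeff 1 formalXJ = 744 := by
  have h0E : coeff 0 (formalE4 ^ 3) = 1 := by
    rw [coeff_zero_eq_constantCoeff_apply, map_pow, constantCoeff_formalE4, one_pow]
  have h0D : coeff 0 (PowerSeries.invOfUnit formalDeltaUnit 1) = 1 := by
    rw [coeff_zero_eq_constantCoeff_apply, constantCoeff_invOfUnit, inv_one, Units.val_one]
  rw [formalXJ, coeff_one_mul, h0E, h0D, coeff_one_formalE4_pow_three,
    coeff_one_invOfUnit_formalDeltaUnit]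
  norm_num

/-- `coeff 0 (q·j) = 1`. [folklore] -/
@[simp]
theorem coeff_zero_formalXJ : coeff 0 formalXJ = 1 := by
  rw [coeff_zero_eq_constantCoeff_apply, constantCoeff_formalXJ]

/-! ### Non-archimedean evaluation of integer formal power series -/

section Eval

variable {K : Type*} [NormedField K] [IsUltrametricDist K] [CompleteSpace K]

/-- Evaluation of an integer formal power series at a point of the open unit disc of a complete
ultrametric field: `evalSeries φ z = ∑' n, (coeff n φ) zⁿ`. [folklore] -/
def evalSeries (φ : PowerSeries ℤ) (z : K) : K :=
  ∑' n, ((coeff n φ : ℤ) : K) * z ^ n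

omit [CompleteSpace K] in
/-- Integer coefficients have norm `≤ 1`, so the general term is bounded by `‖z‖ⁿ`. [folklore] -/
theorem norm_coeff_mul_pow_le (φ : PowerSeries ℤ) (z : K) (n : ℕ) :
    ‖((coeff n φ : ℤ) : K) * z ^ n‖ ≤ ‖z‖ ^ n := by
  rw [norm_mul, norm_pow]
  exact mul_le_of_le_one_left (pow_nonneg (norm_nonneg _) _) (norm_intCast_le_one K _)

omit [CompleteSpace K] in
/-- Norm-summability of the evaluation series on the open unit disc. [folklore] -/
theorem summable_norm_coeff_mul_pow (φ : PowerSeries ℤ) {z : K} (hz : ‖z‖ < 1) :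
    Summable fun n ↦ ‖((coeff n φ : ℤ) : K) * z ^ n‖ :=
  Summable.of_nonneg_of_le (fun _ ↦ norm_nonneg _) (norm_coeff_mul_pow_le φ z)
    (summable_geometric_of_lt_one (norm_nonneg _) hz)

/-- Summability of the evaluation series on the open unit disc. [folklore] -/
theorem summable_coeff_mul_pow (φ : PowerSeries ℤ) {z : K} (hz : ‖z‖ < 1) :
    Summable fun n ↦ ((coeff n φ : ℤ) : K) * z ^ n :=
  (summable_norm_coeff_mul_pow φ hz).of_norm

/-- The evaluation series sums to `evalSeries φ z`. [folklore] -/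
theorem hasSum_evalSeries (φ : PowerSeries ℤ) {z : K} (hz : ‖z‖ < 1) :
    HasSum (fun n ↦ ((coeff n φ : ℤ) : K) * z ^ n) (evalSeries φ z) :=
  (summable_coeff_mul_pow φ hz).hasSum

omit [CompleteSpace K] in
/-- `‖evalSeries φ z‖ ≤ 1` for `‖z‖ ≤ 1`. [folklore] -/
theorem norm_evalSeries_le_one (φ : PowerSeries ℤ) {z : K} (hz : ‖z‖ ≤ 1) :
    ‖evalSeries φ z‖ ≤ 1 :=
  norm_tsum_le_of_forall_le_of_nonneg zero_le_one fun n ↦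
    (norm_coeff_mul_pow_le φ z n).trans (pow_le_one₀ (norm_nonneg _) hz)

omit [IsUltrametricDist K] [CompleteSpace K] in
/-- `evalSeries 1 z = 1`. [folklore] -/
@[simp]
theorem evalSeries_one (z : K) : evalSeries 1 z = 1 := by
  rw [evalSeries, tsum_eq_single 0 fun n hn ↦ by simp [coeff_one, hn]]
  simp

omit [IsUltrametricDist K] [CompleteSpace K] in
/-- `evalSeries (X^k) z = z^k`. [folklore] -/
theorem evalSeries_X_pow (k : ℕ) (z : K) : evalSeries (X ^ k) z = z ^ k := by
  rw [evalSeries, tsum_eq_single k fun n hn ↦ by simp [coeff_X_pow, hn]]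
  simp [coeff_X_pow]

/-- Additivity of evaluation on the open unit disc. [folklore] -/
theorem evalSeries_add (φ ψ : PowerSeries ℤ) {z : K} (hz : ‖z‖ < 1) :
    evalSeries (φ + ψ) z = evalSeries φ z + evalSeries ψ z := by
  rw [evalSeries, evalSeries, evalSeries, ← (summable_coeff_mul_pow φ hz).tsum_add
    (summable_coeff_mul_pow ψ hz)]
  exact tsum_congr fun n ↦ by simp only [map_add, Int.cast_add]; ring

omit [IsUltrametricDist K] [CompleteSpace K] in
/-- Evaluation commutes with negation. [folklore] -/
theorem evalSeries_neg (φ : PowerSeries ℤ) (z : K) : evalSeries (-φ) z = -evalSeries φ z := by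
  rw [evalSeries, evalSeries, ← tsum_neg]
  exact tsum_congr fun n ↦ by simp only [map_neg, Int.cast_neg]; ring

/-- Evaluation commutes with subtraction on the open unit disc. [folklore] -/
theorem evalSeries_sub (φ ψ : PowerSeries ℤ) {z : K} (hz : ‖z‖ < 1) :
    evalSeries (φ - ψ) z = evalSeries φ z - evalSeries ψ z := by
  rw [sub_eq_add_neg, evalSeries_add _ _ hz, evalSeries_neg, ← sub_eq_add_neg]

/-- **Multiplicativity of evaluation** (Cauchy product of norm-summable series). [folklore] -/
theorem evalSeries_mul (φ ψ : PowerSeries ℤ) {z : K} (hz : ‖z‖ < 1) :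
    evalSeries (φ * ψ) z = evalSeries φ z * evalSeries ψ z := by
  have h : ((∑' n, ((coeff n φ : ℤ) : K) * z ^ n) * ∑' n, ((coeff n ψ : ℤ) : K) * z ^ n) =
      ∑' n, ∑ kl ∈ Finset.antidiagonal n,
        ((coeff kl.1 φ : ℤ) : K) * z ^ kl.1 * (((coeff kl.2 ψ : ℤ) : K) * z ^ kl.2) :=
    tsum_mul_tsum_eq_tsum_sum_antidiagonal_of_summable_norm (R := K)
      (summable_norm_coeff_mul_pow φ hz) (summable_norm_coeff_mul_pow ψ hz)
  simp only [evalSeries]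
  rw [h]
  refine tsum_congr fun n ↦ ?_
  rw [coeff_mul, Int.cast_sum, Finset.sum_mul]
  refine Finset.sum_congr rfl fun kl hkl ↦ ?_
  rw [Finset.mem_antidiagonal] at hkl
  rw [Int.cast_mul, ← hkl, pow_add]
  ring

/-- Evaluation commutes with powers on the open unit disc. [folklore] -/
theorem evalSeries_pow (φ : PowerSeries ℤ) {z : K} (hz : ‖z‖ < 1) (k : ℕ) :
    evalSeries (φ ^ k) z = evalSeries φ z ^ k := by
  induction k with
  | zero => simp
  | succ k ih => rw [pow_succ, evalSeries_mul _ _ hz, ih, pow_succ]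

/-- Evaluation commutes with finite products on the open unit disc. [folklore] -/
theorem evalSeries_prod {ι : Type*} (s : Finset ι) (φ : ι → PowerSeries ℤ) {z : K}
    (hz : ‖z‖ < 1) : evalSeries (∏ i ∈ s, φ i) z = ∏ i ∈ s, evalSeries (φ i) z := by
  classical
  induction s using Finset.induction_on with
  | empty => simp
  | insert a s has ih => rw [Finset.prod_insert has, Finset.prod_insert has,
      evalSeries_mul _ _ hz, ih]

/-! ### Evaluations of `E₄`, `Δ/q` and `q·j` -/

/-- `evalSeries formalE4 q = E₄(q)` (`Literature.NumberTheory.EllipticCurves.tateE4`) for `‖q‖ < 1`. [folklore] -/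
theorem evalSeries_formalE4 {q : K} (hq : ‖q‖ < 1) : evalSeries formalE4 q = tateE4 q := by
  rw [evalSeries, (summable_coeff_mul_pow formalE4 hq).tsum_eq_zero_add, tateE4, ← tsum_mul_left]
  congr 1
  · simp
  · refine tsum_congr fun n ↦ ?_
    rw [coeff_formalE4, if_neg (Nat.succ_ne_zero n)]
    push_cast
    ring

/-- `evalSeries (deltaFactorProd N) q = ∏_{m<N} (1 - q^{m+1})²⁴`. [folklore] -/
theorem evalSeries_deltaFactorProd (N : ℕ) {q : K} (hq : ‖q‖ < 1) :
    evalSeries (deltaFactorProd N) q = ∏ m ∈ Finset.range N, (1 - q ^ (m + 1)) ^ 24 := by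
  rw [deltaFactorProd, evalSeries_prod _ _ hq]
  refine Finset.prod_congr rfl fun m _ ↦ ?_
  rw [evalSeries_pow _ hq, evalSeries_sub _ _ hq, evalSeries_one, evalSeries_X_pow]

/-- The evaluation of `Δ/q` is the limit of the truncated products: the difference
`evalSeries formalDeltaUnit q - ∏_{m<N} (1 - q^{m+1})²⁴` has norm `≤ ‖q‖^{N+1}`. [folklore] -/
theorem norm_evalSeries_formalDeltaUnit_sub_le (N : ℕ) {q : K} (hq : ‖q‖ < 1) :
    ‖evalSeries formalDeltaUnit q - ∏ m ∈ Finset.range N, (1 - q ^ (m + 1)) ^ 24‖ ≤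
      ‖q‖ ^ (N + 1) := by
  rw [← evalSeries_deltaFactorProd N hq, ← evalSeries_sub _ _ hq, evalSeries]
  refine norm_tsum_le_of_forall_le_of_nonneg (by positivity) fun n ↦ ?_
  rcases le_or_gt n N with hn | hn
  · rw [map_sub, coeff_formalDeltaUnit hn, sub_self, Int.cast_zero, zero_mul, norm_zero]
    positivity
  · exact (norm_coeff_mul_pow_le _ q n).trans
      (pow_le_pow_of_le_one (norm_nonneg _) hq.le (by omega))

/-- `evalSeries formalDeltaUnit q = ∏_{m ≥ 1} (1 - qᵐ)²⁴ = Δ(q)/q` for `‖q‖ < 1`. [folklore] -/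
theorem evalSeries_formalDeltaUnit {q : K} (hq : ‖q‖ < 1) :
    evalSeries formalDeltaUnit q = ∏' m : ℕ, (1 - q ^ (m + 1)) ^ 24 := by
  have hprod := (multipliable_tateDelta_factor hq).hasProd.tendsto_prod_nat
  have hlim : Tendsto (fun N : ℕ ↦ ∏ m ∈ Finset.range N, (1 - q ^ (m + 1)) ^ 24) atTop
      (𝓝 (evalSeries formalDeltaUnit q)) := by
    refine tendsto_iff_norm_sub_tendsto_zero.mpr ?_
    have h0 : Tendsto (fun N : ℕ ↦ ‖q‖ ^ (N + 1)) atTop (𝓝 0) :=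
      (tendsto_pow_atTop_nhds_zero_of_lt_one (norm_nonneg _) hq).comp (tendsto_add_atTop_nat 1)
    refine squeeze_zero (fun _ ↦ norm_nonneg _) (fun N ↦ ?_) h0
    rw [norm_sub_rev]
    exact norm_evalSeries_formalDeltaUnit_sub_le N hq
  exact tendsto_nhds_unique hlim hprod

/-- `evalSeries formalDeltaUnit q ≠ 0` (it has norm `1`). [folklore] -/
theorem evalSeries_formalDeltaUnit_ne_zero {q : K} (hq : ‖q‖ < 1) :
    evalSeries formalDeltaUnit q ≠ 0 := by
  rw [evalSeries_formalDeltaUnit hq, ← norm_pos_iff, norm_tprod_tateDelta_factor_eq_one hq]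
  exact one_pos

/-- The evaluation of `(Δ/q)⁻¹` is the inverse of the evaluation. [folklore] -/
theorem evalSeries_invOfUnit_formalDeltaUnit {q : K} (hq : ‖q‖ < 1) :
    evalSeries (PowerSeries.invOfUnit formalDeltaUnit 1) q = (evalSeries formalDeltaUnit q)⁻¹ := by
  have h := congrArg (fun φ ↦ evalSeries φ q) formalDeltaUnit_mul_invOfUnit
  simp only [evalSeries_mul _ _ hq, evalSeries_one] at h
  exact (eq_inv_of_mul_eq_one_right h)

/-- `q · Δ-normalised`: `tateDelta q = q · evalSeries formalDeltaUnit q`. [folklore] -/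
theorem tateDelta_eq_mul_evalSeries {q : K} (hq : ‖q‖ < 1) :
    tateDelta q = q * evalSeries formalDeltaUnit q := by
  rw [tateDelta, evalSeries_formalDeltaUnit hq]

/-- **`p`-adic (non-archimedean) evaluation of the integer `q`-expansion of `q · j(q)`**: for
`0 < ‖q‖ < 1` in a complete ultrametric field,
`∑ₙ coeffₙ(formalXJ) qⁿ = q · j(q)` with `j(q) = E₄(q)³/Δ(q) = Literature.NumberTheory.EllipticCurves.tateJ q`.
This is the bridge between the formal identity world (`ℤ⟦q⟧`, where the modular equations
live) and the `p`-adic values `J(q)` of the Mahler–Manin theorem. [folklore] -/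
theorem evalSeries_formalXJ {q : K} (hq0 : q ≠ 0) (hq : ‖q‖ < 1) :
    evalSeries formalXJ q = q * tateJ q := by
  rw [formalXJ, evalSeries_mul _ _ hq, evalSeries_pow _ hq, evalSeries_formalE4 hq,
    evalSeries_invOfUnit_formalDeltaUnit hq, tateJ, tateDelta_eq_mul_evalSeries hq]
  field_simp [evalSeries_formalDeltaUnit_ne_zero hq]

/-- The same as a `HasSum` statement: `HasSum (n ↦ coeffₙ(formalXJ) qⁿ) (q · j(q))`. [folklore] -/
theorem hasSum_coeff_formalXJ {q : K} (hq0 : q ≠ 0) (hq : ‖q‖ < 1) :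
    HasSum (fun n ↦ ((coeff n formalXJ : ℤ) : K) * q ^ n) (q * tateJ q) :=
  evalSeries_formalXJ hq0 hq ▸ hasSum_evalSeries formalXJ hq

end Eval

end Literature.NumberTheory.EllipticCurves

end
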